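import Mathlib
import Summits.Ventures.PercRepro.PuncturedLYMTriplesSymPos

/-!
# PercRepro — (SP) FOR THREE PAIRWISE DISJOINT TRIPLES AT LEVEL 4 ON EVERY GROUND SET: THE COLUMN EQUATIONS A (TYPES 1–13)
(p10, gen 39)

The 26 column equations of the certificate at the free columns: for every column type `(b₁, b₂, b₃)` (free count
`5 − Σ b_i`) the weights of its `b_i` rows in the direction of member `i` and of its `bF` rows in the free direction add up
to `1` (entries) — i.e. to `1/#Y` for the normalised type weights `W`. The member columns are paid `1/3` by each of their
three rows (`e_2_H`, `e_0_2_H`, …, the entries on the adjacent layers). Nothing here asserts (SP).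
-/

namespace PercRepro.PuncturedLYM.Split.TypeLift.TriplesSym

open Finset

/-- The column equation of the free column type `(0, 0, 0)` (free count `5`), in the entries. -/
theorem col_0_0_0 (m : ℚ) (_hm : 0 ≤ m) : 5 * e_0_0_0_F m = 1 := by
  norm_num [e_0_0_0_F]

/-- The column equation of the free column type `(0, 0, 0)`, in the type weights. -/
theorem colW_0_0_0 (m : ℚ) (hm : 0 ≤ m) :
    ((0 : ℕ) : ℚ) * W m ![0 - 1, 0, 0] 5 (some 0) +
      ((0 : ℕ) : ℚ) * W m ![0, 0 - 1, 0] 5 (some 1) +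
      ((0 : ℕ) : ℚ) * W m ![0, 0, 0 - 1] 5 (some 2) +
      ((5 : ℕ) : ℚ) * W m ![0, 0, 0] (5 - 1) none = 1 / Y m := by
  have key := col_0_0_0 m hm
  have hY := Y_pos m hm
  simp (config := {decide := true}) only [W, h1, h2, h3, hF, if_true, if_false]
  field_simp
  linear_combination key

/-- The column equation of the free column type `(0, 0, 1)` (free count `4`), in the entries. -/
theorem col_0_0_1 (m : ℚ) (hm : 0 ≤ m) : 1 * e_0_0_0_H m + 4 * e_0_0_1_F m = 1 := by
  unfold e_0_0_0_H e_0_0_1_F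
  field_simp
  ring

/-- The column equation of the free column type `(0, 0, 1)`, in the type weights. -/
theorem colW_0_0_1 (m : ℚ) (hm : 0 ≤ m) :
    ((0 : ℕ) : ℚ) * W m ![0 - 1, 0, 1] 4 (some 0) +
      ((0 : ℕ) : ℚ) * W m ![0, 0 - 1, 1] 4 (some 1) +
      ((1 : ℕ) : ℚ) * W m ![0, 0, 1 - 1] 4 (some 2) +
      ((4 : ℕ) : ℚ) * W m ![0, 0, 1] (4 - 1) none = 1 / Y m := by
  have key := col_0_0_1 m hm
  have hY := Y_pos m hm
  simp (config := {decide := true}) only [W, h1, h2, h3, hF, if_true, if_false]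
  field_simp
  linear_combination key

/-- The column equation of the free column type `(0, 0, 2)` (free count `3`), in the entries. -/
theorem col_0_0_2 (m : ℚ) (hm : 0 ≤ m) : 2 * e_0_0_1_H m + 3 * e_0_0_2_F m = 1 := by
  unfold e_0_0_1_H e_0_0_2_F
  field_simp
  ring

/-- The column equation of the free column type `(0, 0, 2)`, in the type weights. -/
theorem colW_0_0_2 (m : ℚ) (hm : 0 ≤ m) :
    ((0 : ℕ) : ℚ) * W m ![0 - 1, 0, 2] 3 (some 0) +
      ((0 : ℕ) : ℚ) * W m ![0, 0 - 1, 2] 3 (some 1) +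
      ((2 : ℕ) : ℚ) * W m ![0, 0, 2 - 1] 3 (some 2) +
      ((3 : ℕ) : ℚ) * W m ![0, 0, 2] (3 - 1) none = 1 / Y m := by
  have key := col_0_0_2 m hm
  have hY := Y_pos m hm
  simp (config := {decide := true}) only [W, h1, h2, h3, hF, if_true, if_false]
  field_simp
  linear_combination key

/-- The column equation of the free column type `(0, 1, 0)` (free count `4`), in the entries. -/
theorem col_0_1_0 (m : ℚ) (hm : 0 ≤ m) : 1 * e_0_0_H m + 4 * e_0_1_0_F m = 1 := by
  unfold e_0_0_H e_0_1_0_F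
  field_simp
  ring

/-- The column equation of the free column type `(0, 1, 0)`, in the type weights. -/
theorem colW_0_1_0 (m : ℚ) (hm : 0 ≤ m) :
    ((0 : ℕ) : ℚ) * W m ![0 - 1, 1, 0] 4 (some 0) +
      ((1 : ℕ) : ℚ) * W m ![0, 1 - 1, 0] 4 (some 1) +
      ((0 : ℕ) : ℚ) * W m ![0, 1, 0 - 1] 4 (some 2) +
      ((4 : ℕ) : ℚ) * W m ![0, 1, 0] (4 - 1) none = 1 / Y m := by
  have key := col_0_1_0 m hm
  have hY := Y_pos m hm
  simp (config := {decide := true}) only [W, h1, h2, h3, hF, if_true, if_false]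
  field_simp
  linear_combination key

/-- The column equation of the free column type `(0, 1, 1)` (free count `3`), in the entries. -/
theorem col_0_1_1 (m : ℚ) (hm : 0 ≤ m) : 1 * e_0_0_H m + 1 * e_0_1_0_H m + 3 * e_0_1_1_F m = 1 := by
  unfold e_0_0_H e_0_1_0_H e_0_1_1_F
  field_simp
  ring

/-- The column equation of the free column type `(0, 1, 1)`, in the type weights. -/
theorem colW_0_1_1 (m : ℚ) (hm : 0 ≤ m) :
    ((0 : ℕ) : ℚ) * W m ![0 - 1, 1, 1] 3 (some 0) +
      ((1 : ℕ) : ℚ) * W m ![0, 1 - 1, 1] 3 (some 1) +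
      ((1 : ℕ) : ℚ) * W m ![0, 1, 1 - 1] 3 (some 2) +
      ((3 : ℕ) : ℚ) * W m ![0, 1, 1] (3 - 1) none = 1 / Y m := by
  have key := col_0_1_1 m hm
  have hY := Y_pos m hm
  simp (config := {decide := true}) only [W, h1, h2, h3, hF, if_true, if_false]
  field_simp
  linear_combination key

/-- The column equation of the free column type `(0, 1, 2)` (free count `2`), in the entries. -/
theorem col_0_1_2 (m : ℚ) (hm : 0 ≤ m) : 1 * e_0_0_H m + 2 * e_0_1_1_H m + 2 * e_0_1_2_F m = 1 := by
  unfold e_0_0_H e_0_1_1_H e_0_1_2_F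
  field_simp
  ring

/-- The column equation of the free column type `(0, 1, 2)`, in the type weights. -/
theorem colW_0_1_2 (m : ℚ) (hm : 0 ≤ m) :
    ((0 : ℕ) : ℚ) * W m ![0 - 1, 1, 2] 2 (some 0) +
      ((1 : ℕ) : ℚ) * W m ![0, 1 - 1, 2] 2 (some 1) +
      ((2 : ℕ) : ℚ) * W m ![0, 1, 2 - 1] 2 (some 2) +
      ((2 : ℕ) : ℚ) * W m ![0, 1, 2] (2 - 1) none = 1 / Y m := by
  have key := col_0_1_2 m hm
  have hY := Y_pos m hm
  simp (config := {decide := true}) only [W, h1, h2, h3, hF, if_true, if_false]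
  field_simp
  linear_combination key

/-- The column equation of the free column type `(0, 2, 0)` (free count `3`), in the entries. -/
theorem col_0_2_0 (m : ℚ) (hm : 0 ≤ m) : 2 * e_0_1_H m + 3 * e_0_2_0_F m = 1 := by
  unfold e_0_1_H e_0_2_0_F
  field_simp
  ring

/-- The column equation of the free column type `(0, 2, 0)`, in the type weights. -/
theorem colW_0_2_0 (m : ℚ) (hm : 0 ≤ m) :
    ((0 : ℕ) : ℚ) * W m ![0 - 1, 2, 0] 3 (some 0) +
      ((2 : ℕ) : ℚ) * W m ![0, 2 - 1, 0] 3 (some 1) +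
      ((0 : ℕ) : ℚ) * W m ![0, 2, 0 - 1] 3 (some 2) +
      ((3 : ℕ) : ℚ) * W m ![0, 2, 0] (3 - 1) none = 1 / Y m := by
  have key := col_0_2_0 m hm
  have hY := Y_pos m hm
  simp (config := {decide := true}) only [W, h1, h2, h3, hF, if_true, if_false]
  field_simp
  linear_combination key

/-- The column equation of the free column type `(0, 2, 1)` (free count `2`), in the entries. -/
theorem col_0_2_1 (m : ℚ) (hm : 0 ≤ m) : 2 * e_0_1_H m + 1 * e_0_2_0_H m + 2 * e_0_2_1_F m = 1 := by
  unfold e_0_1_H e_0_2_0_H e_0_2_1_F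
  field_simp
  ring

/-- The column equation of the free column type `(0, 2, 1)`, in the type weights. -/
theorem colW_0_2_1 (m : ℚ) (hm : 0 ≤ m) :
    ((0 : ℕ) : ℚ) * W m ![0 - 1, 2, 1] 2 (some 0) +
      ((2 : ℕ) : ℚ) * W m ![0, 2 - 1, 1] 2 (some 1) +
      ((1 : ℕ) : ℚ) * W m ![0, 2, 1 - 1] 2 (some 2) +
      ((2 : ℕ) : ℚ) * W m ![0, 2, 1] (2 - 1) none = 1 / Y m := by
  have key := col_0_2_1 m hm
  have hY := Y_pos m hm
  simp (config := {decide := true}) only [W, h1, h2, h3, hF, if_true, if_false]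
  field_simp
  linear_combination key

/-- The column equation of the free column type `(0, 2, 2)` (free count `1`), in the entries. -/
theorem col_0_2_2 (m : ℚ) (hm : 0 ≤ m) : 2 * e_0_1_H m + 2 * e_0_2_1_H m + 1 * e_0_2_2_F m = 1 := by
  unfold e_0_1_H e_0_2_1_H e_0_2_2_F
  field_simp
  ring

/-- The column equation of the free column type `(0, 2, 2)`, in the type weights. -/
theorem colW_0_2_2 (m : ℚ) (hm : 0 ≤ m) :
    ((0 : ℕ) : ℚ) * W m ![0 - 1, 2, 2] 1 (some 0) +
      ((2 : ℕ) : ℚ) * W m ![0, 2 - 1, 2] 1 (some 1) +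
      ((2 : ℕ) : ℚ) * W m ![0, 2, 2 - 1] 1 (some 2) +
      ((1 : ℕ) : ℚ) * W m ![0, 2, 2] (1 - 1) none = 1 / Y m := by
  have key := col_0_2_2 m hm
  have hY := Y_pos m hm
  simp (config := {decide := true}) only [W, h1, h2, h3, hF, if_true, if_false]
  field_simp
  linear_combination key

/-- The column equation of the free column type `(1, 0, 0)` (free count `4`), in the entries. -/
theorem col_1_0_0 (m : ℚ) (hm : 0 ≤ m) : 1 * e_0_H m + 4 * e_1_0_0_F m = 1 := by
  unfold e_0_H e_1_0_0_F
  field_simp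
  ring

/-- The column equation of the free column type `(1, 0, 0)`, in the type weights. -/
theorem colW_1_0_0 (m : ℚ) (hm : 0 ≤ m) :
    ((1 : ℕ) : ℚ) * W m ![1 - 1, 0, 0] 4 (some 0) +
      ((0 : ℕ) : ℚ) * W m ![1, 0 - 1, 0] 4 (some 1) +
      ((0 : ℕ) : ℚ) * W m ![1, 0, 0 - 1] 4 (some 2) +
      ((4 : ℕ) : ℚ) * W m ![1, 0, 0] (4 - 1) none = 1 / Y m := by
  have key := col_1_0_0 m hm
  have hY := Y_pos m hm
  simp (config := {decide := true}) only [W, h1, h2, h3, hF, if_true, if_false]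
  field_simp
  linear_combination key

/-- The column equation of the free column type `(1, 0, 1)` (free count `3`), in the entries. -/
theorem col_1_0_1 (m : ℚ) (hm : 0 ≤ m) : 1 * e_0_H m + 1 * e_1_0_0_H m + 3 * e_1_0_1_F m = 1 := by
  unfold e_0_H e_1_0_0_H e_1_0_1_F
  field_simp
  ring

/-- The column equation of the free column type `(1, 0, 1)`, in the type weights. -/
theorem colW_1_0_1 (m : ℚ) (hm : 0 ≤ m) :
    ((1 : ℕ) : ℚ) * W m ![1 - 1, 0, 1] 3 (some 0) +
      ((0 : ℕ) : ℚ) * W m ![1, 0 - 1, 1] 3 (some 1) +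
      ((1 : ℕ) : ℚ) * W m ![1, 0, 1 - 1] 3 (some 2) +
      ((3 : ℕ) : ℚ) * W m ![1, 0, 1] (3 - 1) none = 1 / Y m := by
  have key := col_1_0_1 m hm
  have hY := Y_pos m hm
  simp (config := {decide := true}) only [W, h1, h2, h3, hF, if_true, if_false]
  field_simp
  linear_combination key

/-- The column equation of the free column type `(1, 0, 2)` (free count `2`), in the entries. -/
theorem col_1_0_2 (m : ℚ) (hm : 0 ≤ m) : 1 * e_0_H m + 2 * e_1_0_1_H m + 2 * e_1_0_2_F m = 1 := by
  unfold e_0_H e_1_0_1_H e_1_0_2_F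
  field_simp
  ring

/-- The column equation of the free column type `(1, 0, 2)`, in the type weights. -/
theorem colW_1_0_2 (m : ℚ) (hm : 0 ≤ m) :
    ((1 : ℕ) : ℚ) * W m ![1 - 1, 0, 2] 2 (some 0) +
      ((0 : ℕ) : ℚ) * W m ![1, 0 - 1, 2] 2 (some 1) +
      ((2 : ℕ) : ℚ) * W m ![1, 0, 2 - 1] 2 (some 2) +
      ((2 : ℕ) : ℚ) * W m ![1, 0, 2] (2 - 1) none = 1 / Y m := by
  have key := col_1_0_2 m hm
  have hY := Y_pos m hm
  simp (config := {decide := true}) only [W, h1, h2, h3, hF, if_true, if_false]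
  field_simp
  linear_combination key

/-- The column equation of the free column type `(1, 1, 0)` (free count `3`), in the entries. -/
theorem col_1_1_0 (m : ℚ) (hm : 0 ≤ m) : 1 * e_0_H m + 1 * e_1_0_H m + 3 * e_1_1_0_F m = 1 := by
  unfold e_0_H e_1_0_H e_1_1_0_F
  field_simp
  ring

/-- The column equation of the free column type `(1, 1, 0)`, in the type weights. -/
theorem colW_1_1_0 (m : ℚ) (hm : 0 ≤ m) :
    ((1 : ℕ) : ℚ) * W m ![1 - 1, 1, 0] 3 (some 0) +
      ((1 : ℕ) : ℚ) * W m ![1, 1 - 1, 0] 3 (some 1) +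
      ((0 : ℕ) : ℚ) * W m ![1, 1, 0 - 1] 3 (some 2) +
      ((3 : ℕ) : ℚ) * W m ![1, 1, 0] (3 - 1) none = 1 / Y m := by
  have key := col_1_1_0 m hm
  have hY := Y_pos m hm
  simp (config := {decide := true}) only [W, h1, h2, h3, hF, if_true, if_false]
  field_simp
  linear_combination key

end PercRepro.PuncturedLYM.Split.TypeLift.TriplesSym
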